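import Summits.FinalStateConjecture.FinalStateConjecture.Theorems.BartnikGapSettlingBondiBartnikRigidityMarchingLemmaCollarSetBasic
import Summits.FinalStateConjecture.FinalStateConjecture.Theorems.BartnikGapSettlingBondiBartnikRigiditySlabCauchyRigidityLensConnected
import Literature.Geometry.Lorentzian.KerrHyperboloidalLeaves
import Literature.Geometry.Lorentzian.KerrHorizonRegularWaveBoundednessProofs
import HarnessLib

/-!
# K2b-5 `stub_marchingLemma`, brick 19: the Kerr-time level sets of `J⁺_K(slab)°` are connected —
# line `direct-method-on-the-cone` (crux `BondiBartnikRigidity`, stmt-FinalStateConjecture-10807)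

`isConnected_levelSet`: for `σ > 0` the level set `S_σ = {z ∈ E3 : (σ, z) ∈ W}` of `W = J⁺_K(slab)°`
(star chart `Kerr.spacetime M a M`, `0 < M`, `|a| < M`) is an open connected subset of `E3` — the
connected slice piece over which the kite of the marching step is erected (report K2b-a2 §4).  Proof: `S_σ`
contains the annulus `{M < r < 3M}` (the open cylinder lies in `W`), which is connected
(`F1Route.isConnected_slabW`); a point `z ∈ S_σ` is the end of a causal curve `γ` from a slab point `p`;
pushing `γ` up to the level, `s ↦ (σ, γ̂(s)) = T_{σ − t*(γ s)} (γ s)`, gives a path in `S_σ` (`J⁺_K(slab)`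
is invariant under future translations, and STRICT translates are interior,
`CollarK.translate_mem_interior_of_mem_frontier`) from `z` to the point above `p`, which has
`M < r ≤ 3M` and is joined to the annulus by a short radial segment (`r` strictly increases along the
position vector, `Kerr.radiusGrad_apply_eq`).

References: Dafermos–Rodnianski arXiv:0811.0354, §5.1 [DafermosRodnianski2008]; O'Neill 1995, Ch. 2, §2.1
[ONeill1995].  No definitions, no named facts.
-/

noncomputable section

-- D-0017: single-problem summit, `Summit.<S>.<S>.…` by design (cf. lakefile `weak.linter.dupNamespace`).
set_option linter.dupNamespace false
set_option maxSynthPendingDepth 3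

open Set Filter Function Topology TopologicalSpace Metric
open Literature.Geometry.Lorentzian
open scoped Topology RealInnerProductSpace

namespace Summit.FinalStateConjecture.FinalStateConjecture.Theorems.BondiBartnikRigidity.DirectMethod

namespace LevelK

open FutureK (translate_mem_region)

variable [Kerr.Facts] {M a : ℝ}

omit [Kerr.Facts] in
/-- **`r` strictly increases along the position vector**: `dr_y(y) > 0` for `y ≠ 0` with `r > 0`, so
`r(μ y) < r(y)` for `μ < 1` close to `1`. [cite: arXiv07060622, (35)] -/
theorem eventually_radius_smul_lt {a : ℝ} {y : E3} (hy : y ≠ 0) (hr : 0 < Kerr.radius a (E4.ofTimeSpace 0 y)) :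
    ∀ᶠ μ in 𝓝[<] (1 : ℝ), Kerr.radius a (E4.ofTimeSpace 0 (μ • y)) < Kerr.radius a (E4.ofTimeSpace 0 y) := by
  set g : ℝ → ℝ := fun μ => Kerr.radius a (E4.ofTimeSpace 0 (μ • y)) with hg
  have hline : HasDerivAt (fun μ : ℝ => μ • y) y 1 := by simpa using (hasDerivAt_id (1 : ℝ)).smul_const y
  have hF := Kerr.hasFDerivAt_radius_slice (a := a) (y := (1 : ℝ) • y) (by rw [one_smul]; exact hr)
  have hgd' := hF.comp_hasDerivAt 1 hline
  have hgd : HasDerivAt g (Kerr.radiusGrad a y y) 1 := by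
    rw [one_smul] at hgd'; exact hgd'
  have hpos : 0 < Kerr.radiusGrad a y y := by
    rw [Kerr.radiusGrad_apply_eq]
    refine div_pos ?_ (mul_pos hr (Kerr.blSigma_pos hr))
    have h1 : 0 < ‖y‖ ^ 2 := by positivity
    rw [real_inner_self_eq_norm_sq]
    nlinarith [sq_nonneg (a * y 2), mul_pos (pow_pos hr 2) h1]
  -- slope argument
  have hslope := hgd.tendsto_slope_zero_left
  have hev : ∀ᶠ t in 𝓝[<] (0 : ℝ), 0 < t⁻¹ • (g (1 + t) - g 1) :=
    hslope (Ioi_mem_nhds hpos)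
  have hev' : ∀ᶠ t in 𝓝[<] (0 : ℝ), g (1 + t) < g 1 := by
    filter_upwards [hev, self_mem_nhdsWithin] with t ht ht0
    have ht0' : t < 0 := ht0
    rw [smul_eq_mul] at ht
    by_contra hge
    push Not at hge
    have : t⁻¹ * (g (1 + t) - g 1) ≤ 0 := mul_nonpos_of_nonpos_of_nonneg (inv_nonpos.2 ht0'.le) (by linarith)
    linarith
  have hmap : Tendsto (fun μ : ℝ => μ - 1) (𝓝[<] (1 : ℝ)) (𝓝[<] (0 : ℝ)) := by
    refine tendsto_nhdsWithin_of_tendsto_nhds_of_eventually_within _ ?_ ?_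
    · have : Tendsto (fun μ : ℝ => μ - 1) (𝓝 (1 : ℝ)) (𝓝 (1 - 1)) := (continuous_sub_right (1 : ℝ)).tendsto 1
      rw [sub_self] at this
      exact this.mono_left nhdsWithin_le_nhds
    · filter_upwards [self_mem_nhdsWithin] with μ hμ
      show μ - 1 < 0; have : μ < 1 := hμ; linarith
  have := hmap.eventually hev'
  filter_upwards [this] with μ hμ
  have h1 : g (1 + (μ - 1)) = g μ := by congr 1; ring
  rw [h1] at hμ
  simpa [hg] using hμ

/-- **The Kerr-time level sets of `W = J⁺_K(slab)°` are open and connected** for `σ > 0`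
(see the module docstring). [cite: DafermosRodnianski2008, §5.1] -/
theorem isConnected_levelSet (hM : 0 < M) (ha : |a| < M)
    (hcyl : {y : Kerr.region a M | 0 ≤ y.1 0 ∧ Kerr.radius a y.1 ≤ 3 * M} ⊆ JK M a hM (slabK M a))
    (hfr : frontier (JK M a hM (slabK M a)) ⊆ slabK M a ∪ JK M a hM (outerSphereK M a))
    {σ : ℝ} (hσ : 0 < σ) :
    IsOpen {z : E3 | ∃ hz : E4.ofTimeSpace σ z ∈ Kerr.region a M,
      (⟨E4.ofTimeSpace σ z, hz⟩ : Kerr.region a M) ∈ interior (JK M a hM (slabK M a))} ∧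
    IsConnected {z : E3 | ∃ hz : E4.ofTimeSpace σ z ∈ Kerr.region a M,
      (⟨E4.ofTimeSpace σ z, hz⟩ : Kerr.region a M) ∈ interior (JK M a hM (slabK M a))} := by
  set W := interior (JK M a hM (slabK M a)) with hW
  set S : Set E3 := {z : E3 | ∃ hz : E4.ofTimeSpace σ z ∈ Kerr.region a M, (⟨E4.ofTimeSpace σ z, hz⟩ : Kerr.region a M) ∈ W}
    with hS
  have hmax : max M 0 = M := max_eq_left hM.le
  have hJc := FutureK.isClosed_JK_slabK hM hfr
  -- `S` is open
  have hSo : IsOpen S := by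
    rw [isOpen_iff_mem_nhds]
    rintro z ⟨hz, hzW⟩
    have hc : ContinuousAt (E4.ofTimeSpace σ) z := (E4.continuous_ofTimeSpace σ).continuousAt
    have hreg : ∀ᶠ z' in 𝓝 z, E4.ofTimeSpace σ z' ∈ Kerr.region a M :=
      hc.preimage_mem_nhds ((Kerr.region a M).2.mem_nhds hz)
    -- `W` as the preimage of an open set of `E4`
    obtain ⟨V, hVo, hVW⟩ : ∃ V : Set E4, IsOpen V ∧ Subtype.val ⁻¹' V = W := isOpen_induced_iff.1 isOpen_interior
    have hzV : E4.ofTimeSpace σ z ∈ V := by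
      have : (⟨E4.ofTimeSpace σ z, hz⟩ : Kerr.region a M) ∈ Subtype.val ⁻¹' V := by rw [hVW]; exact hzW
      exact this
    filter_upwards [hreg, hc.preimage_mem_nhds (hVo.mem_nhds hzV)] with z' hz' hz'V
    refine ⟨hz', ?_⟩
    show (⟨E4.ofTimeSpace σ z', hz'⟩ : Kerr.region a M) ∈ W
    rw [← hVW]; exact hz'V
  -- strict translates of `J⁺_K(slab)` points are in `W`
  have hup : ∀ (y : Kerr.region a M), y ∈ JK M a hM (slabK M a) → ∀ c, 0 < c →
      (⟨y.1 + c • E4.basisVector 0, translate_mem_region y c⟩ : Kerr.region a M) ∈ W := by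
    intro y hy c hc
    by_cases hint : y ∈ W
    · exact FutureK.interior_JK_slabK_translate_subset hM hcyl hc.le hint
    · exact CollarK.translate_mem_interior_of_mem_frontier hM ha hcyl hfr (by rw [hJc.frontier_eq]; exact ⟨hy, hint⟩) hc
  -- level points above `J⁺_K(slab)` points
  have hlevel : ∀ (y : Kerr.region a M), y ∈ JK M a hM (slabK M a) → y.1 0 ≤ σ → (y.1 0 < σ ∨ y ∈ W) →
      E4.spatial y.1 ∈ S := by
    intro y hy hyσ hor
    have heq : E4.ofTimeSpace σ (E4.spatial y.1) = y.1 + (σ - y.1 0) • E4.basisVector 0 := by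
      conv_rhs => rw [← E4.ofTimeSpace_time_spatial y.1]
      rw [Kerr.ofTimeSpace_add_smul_basisVector_zero]; congr 1; show σ = y.1 0 + (σ - y.1 0); ring
    have hreg : E4.ofTimeSpace σ (E4.spatial y.1) ∈ Kerr.region a M := by rw [heq]; exact translate_mem_region y _
    refine ⟨hreg, ?_⟩
    by_cases hlt : y.1 0 < σ
    · have h := hup y hy (σ - y.1 0) (by linarith)
      convert h using 1; exact Subtype.ext heq
    · have hyt : y.1 0 = σ := le_antisymm hyσ (not_lt.1 hlt)
      have hyW : y ∈ W := hor.resolve_left hlt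
      have hval : E4.ofTimeSpace σ (E4.spatial y.1) = y.1 := by
        rw [heq, hyt, sub_self, zero_smul, add_zero]
      have hgen : ∀ (v : E4) (hv : v ∈ Kerr.region a M), v = y.1 → (⟨v, hv⟩ : Kerr.region a M) ∈ W := by
        rintro v hv rfl; exact hyW
      exact hgen _ hreg hval
  -- the annulus `A₀ = {M < r < 3M}` is a connected subset of `S`
  set A₀ : Set E3 := {y | M < Kerr.radius a (E4.ofTimeSpace 0 y) ∧ Kerr.radius a (E4.ofTimeSpace 0 y) < 3 * M} with hA₀
  have hA₀c : IsConnected A₀ := by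
    have h := (F1Route.isConnected_slabW a hM).image _ continuous_subtype_val.continuousOn
    have heq : Subtype.val '' (F1Route.slabW M a : Set (Kerr.slice a M)) = A₀ := by
      ext y; constructor
      · rintro ⟨w, hw, rfl⟩
        refine ⟨?_, hw⟩
        have := w.2; rw [Kerr.mem_slice_iff_ofTimeSpace_mem_region, Kerr.mem_region, hmax] at this; exact this
      · rintro ⟨h1, h2⟩
        exact ⟨⟨y, by rw [Kerr.mem_slice_iff_ofTimeSpace_mem_region, Kerr.mem_region, hmax]; exact h1⟩, h2, rfl⟩
    rwa [heq] at h
  have hcylW : ∀ y : E3, M < Kerr.radius a (E4.ofTimeSpace 0 y) → Kerr.radius a (E4.ofTimeSpace 0 y) < 3 * M → y ∈ S := by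
    intro y h1 h2
    have hrσ : Kerr.radius a (E4.ofTimeSpace σ y) = Kerr.radius a (E4.ofTimeSpace 0 y) :=
      Kerr.radius_eq_of_spatial_eq a (by rw [E4.spatial_ofTimeSpace, E4.spatial_ofTimeSpace])
    have hreg : E4.ofTimeSpace σ y ∈ Kerr.region a M := by rw [Kerr.mem_region, hmax, hrσ]; exact h1
    refine ⟨hreg, ?_⟩
    have hO : IsOpen {y : Kerr.region a M | 0 < y.1 0 ∧ Kerr.radius a y.1 < 3 * M} :=
      (isOpen_lt continuous_const (K2Route.continuous_tstar a M)).inter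
        (isOpen_lt (K2Route.continuous_radius_region a M) continuous_const)
    refine interior_maximal (fun y hy => hcyl ⟨hy.1.le, hy.2.le⟩) hO ⟨?_, ?_⟩
    · show 0 < (E4.ofTimeSpace σ y) 0; rw [E4.ofTimeSpace_apply_zero]; exact hσ
    · show Kerr.radius a (E4.ofTimeSpace σ y) < 3 * M; rw [hrσ]; exact h2
  have hA₀S : A₀ ⊆ S := fun y hy => hcylW y hy.1 hy.2
  obtain ⟨y₀, hy₀⟩ := hA₀c.nonempty
  -- every point of `S` lies in a connected subset of `S` containing `A₀`
  have key : ∀ z ∈ S, ∃ Cz : Set E3, IsPreconnected Cz ∧ z ∈ Cz ∧ A₀ ⊆ Cz ∧ Cz ⊆ S := by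
    rintro z ⟨hz, hzW⟩
    set x : Kerr.region a M := ⟨E4.ofTimeSpace σ z, hz⟩ with hx
    have hxJ : x ∈ JK M a hM (slabK M a) := interior_subset hzW
    rw [FrontierK.JK_eq] at hxJ
    rcases hxJ with hxs | ⟨p, hp, γ, b₀, b₁, hb, hγ, hγp, hγx⟩
    · exfalso; have : x.1 0 = 0 := hxs.1
      rw [hx] at this; simp [E4.ofTimeSpace_apply_zero] at this; linarith
    -- the pushed-up path
    have hγc : ContinuousOn (fun s => E4.spatial (γ s).1) (Icc b₀ b₁) := fun s hs =>
      (E4.spatial.continuous.continuousAt.comp (continuous_subtype_val.continuousAt.comp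
        (hγ s hs).1.continuousAt)).continuousWithinAt
    have hγJ : ∀ s ∈ Icc b₀ b₁, γ s ∈ JK M a hM (slabK M a) := by
      intro s hs
      rw [FrontierK.JK_eq]
      rcases eq_or_lt_of_le hs.1 with h | h
      · rw [← h, hγp]; exact Or.inl hp
      · exact Or.inr ⟨p, hp, γ, b₀, s, h, hγ.mono (Icc_subset_Icc le_rfl hs.2), hγp, rfl⟩
    have hγt : ∀ s ∈ Icc b₀ b₁, (γ s).1 0 ≤ σ ∧ ((γ s).1 0 < σ ∨ γ s ∈ W) := by
      intro s hs
      have hxt : x.1 0 = σ := by simp [hx, E4.ofTimeSpace_apply_zero]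
      rcases eq_or_lt_of_le hs.2 with h | h
      · refine ⟨?_, Or.inr ?_⟩
        · rw [h, hγx, hxt]
        · rw [h, hγx]; exact hzW
      · have hmono := KerrCausal.strictMonoOn_time ordConnected_Icc hγ hs (right_mem_Icc.2 hb.le) h
        have hmono' : (γ s : E4) 0 < (γ b₁ : E4) 0 := hmono
        rw [hγx, hxt] at hmono'
        exact ⟨hmono'.le, Or.inl hmono'⟩
    set π : ℝ → E3 := fun s => E4.spatial (γ s).1 with hπ
    have hπS : π '' Icc b₀ b₁ ⊆ S := by
      rintro _ ⟨s, hs, rfl⟩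
      exact hlevel (γ s) (hγJ s hs) (hγt s hs).1 (hγt s hs).2
    have hπz : π b₁ = z := by simp [hπ, hγx, hx, E4.spatial_ofTimeSpace]
    -- the base point above `p`, joined to the annulus by a short radial segment
    set w := π b₀ with hw
    have hwp : w = E4.spatial p.1 := by simp [hw, hπ, hγp]
    have hwr : Kerr.radius a (E4.ofTimeSpace 0 w) = Kerr.radius a p.1 := by
      rw [hwp]; exact Kerr.radius_ofTimeSpace_spatial a p.1
    have hw3 : Kerr.radius a (E4.ofTimeSpace 0 w) ≤ 3 * M := by rw [hwr]; exact hp.2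
    have hwM : M < Kerr.radius a (E4.ofTimeSpace 0 w) := by rw [hwr]; exact Kerr.lt_radius_of_mem_region p.2
    have hw0 : w ≠ 0 := by
      intro h0
      have h1 := Kerr.radius_sq a (E4.ofTimeSpace 0 w)
      rw [E4.spatialNorm_ofTimeSpace, h0, norm_zero] at h1
      have h2 : (E4.ofTimeSpace 0 (0 : E3)) 3 = 0 := by
        rw [show (3 : Fin 4) = Fin.succ 2 from rfl, E4.ofTimeSpace_apply_succ]; rfl
      rw [h2] at h1
      have h3 : Kerr.radius a (E4.ofTimeSpace 0 (0 : E3)) ^ 2 = 0 := by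
        rw [h1]; ring_nf; rw [show a ^ 4 = (a ^ 2) ^ 2 by ring, Real.sqrt_sq (sq_nonneg a)]; ring
      have h4 := pow_eq_zero_iff (n := 2) (by norm_num) |>.1 h3
      rw [h0] at hwM; rw [h4] at hwM; linarith
    obtain ⟨μ₁, hμ₁1, hμ₁⟩ : ∃ μ₁ < (1 : ℝ), ∀ μ ∈ Icc μ₁ 1, μ • w ∈ S ∧ (μ < 1 → μ • w ∈ A₀) := by
      have hev1 := eventually_radius_smul_lt (a := a) hw0 (by linarith)
      have hc : ContinuousAt (fun μ : ℝ => Kerr.radius a (E4.ofTimeSpace 0 (μ • w))) 1 :=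
        (((Kerr.continuous_radius a).comp (E4.continuous_ofTimeSpace 0)).comp (continuous_id.smul continuous_const)).continuousAt
      have hev2' : ∀ᶠ μ in 𝓝 (1 : ℝ), M < Kerr.radius a (E4.ofTimeSpace 0 (μ • w)) :=
        hc.preimage_mem_nhds (Ioi_mem_nhds (by show M < Kerr.radius a (E4.ofTimeSpace 0 ((1 : ℝ) • w)); rw [one_smul]; exact hwM))
      have hev2 : ∀ᶠ μ in 𝓝[<] (1 : ℝ), M < Kerr.radius a (E4.ofTimeSpace 0 (μ • w)) :=
        hev2'.filter_mono nhdsWithin_le_nhds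
      obtain ⟨μ₁, hμ₁I, hμ₁⟩ := (mem_nhdsLT_iff_exists_Ico_subset).1 (hev1.and hev2)
      refine ⟨max μ₁ 0, max_lt hμ₁I.out (by norm_num), fun μ hμ => ?_⟩
      rcases eq_or_lt_of_le hμ.2 with h1 | h1
      · rw [h1, one_smul]; exact ⟨hπS ⟨b₀, left_mem_Icc.2 hb.le, rfl⟩, fun h => absurd h (lt_irrefl _)⟩
      · have h := hμ₁ ⟨(le_max_left _ _).trans hμ.1, h1⟩
        have hA : μ • w ∈ A₀ := ⟨h.2, lt_of_lt_of_le h.1 hw3⟩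
        exact ⟨hA₀S hA, fun _ => hA⟩
    set seg : Set E3 := (fun μ : ℝ => μ • w) '' Icc μ₁ 1 with hseg
    have hsegc : IsPreconnected seg := isPreconnected_Icc.image _ (continuous_id.smul continuous_const).continuousOn
    have hsegS : seg ⊆ S := by rintro _ ⟨μ, hμ, rfl⟩; exact (hμ₁ μ hμ).1
    refine ⟨π '' Icc b₀ b₁ ∪ seg ∪ A₀, ?_, Or.inl (Or.inl ⟨b₁, right_mem_Icc.2 hb.le, hπz⟩),
      subset_union_right, union_subset (union_subset hπS hsegS) hA₀S⟩
    refine IsPreconnected.union' ?_ (IsPreconnected.union' ⟨w, ⟨b₀, left_mem_Icc.2 hb.le, rfl⟩,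
      ⟨1, ⟨hμ₁1.le, le_rfl⟩, one_smul _ _⟩⟩ (isPreconnected_Icc.image _ hγc) hsegc) hA₀c.isPreconnected
    exact ⟨μ₁ • w, Or.inr ⟨μ₁, ⟨le_rfl, hμ₁1.le⟩, rfl⟩, (hμ₁ μ₁ ⟨le_rfl, hμ₁1.le⟩).2 hμ₁1⟩
  refine ⟨hSo, ⟨y₀, hA₀S hy₀⟩, ?_⟩
  choose! Cz hCc hzC hAC hCS using key
  have hSeq : S = ⋃ z ∈ S, Cz z := by
    refine Subset.antisymm (fun z hz => mem_iUnion₂.2 ⟨z, hz, hzC z hz⟩) (iUnion₂_subset fun z hz => hCS z hz)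
  rw [hSeq, ← sUnion_image]
  refine isPreconnected_sUnion y₀ _ ?_ ?_
  · rintro _ ⟨z, hz, rfl⟩; exact hAC z hz hy₀
  · rintro _ ⟨z, hz, rfl⟩; exact hCc z hz

end LevelK

/-- **Registered bookkeeping sub-goal `stub_kerrRadiusSmulLt` of the line** (brick of the landing of
K2b-5 `stub_marchingLemma`): the Kerr–Schild radius strictly increases along the position vector, local
form (anchor of this file, whose content is the connectedness of the Kerr-time level sets of
`J⁺_K(slab)°`, `LevelK.isConnected_levelSet`). [cite: arXiv07060622, (35)] -/
theorem stub_kerrRadiusSmulLt : ∀ (a : ℝ) (y : E3), y ≠ 0 → 0 < Kerr.radius a (E4.ofTimeSpace 0 y) →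
    ∀ᶠ μ in 𝓝[<] (1 : ℝ), Kerr.radius a (E4.ofTimeSpace 0 (μ • y)) < Kerr.radius a (E4.ofTimeSpace 0 y) :=
  fun _ _ hy hr => LevelK.eventually_radius_smul_lt hy hr

end Summit.FinalStateConjecture.FinalStateConjecture.Theorems.BondiBartnikRigidity.DirectMethod

end
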